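import Summits.Ventures.PercRepro.C026TheoremP

/-!
# mine-3's Theorem B (B4) / Theorem P: a pendant MARK edge (p5, gen 15; `C026Pendant` is the gen-7 star module)

mine-3 (`proofs/MINE3-BLOCKS.md` §1 (B4), `proofs/MINE3-MONOTONICITY.md` §24): when the mark `b′` is pendant at
`b` — the side `false` of the cut vertex `b` is the single edge `e₀ = bb′` — Theorem B (B3) has `u = t = p = 1`:
`Δ_CF(G; a, b′, c) = Δ_CF(G₁; a, b, c) + #{a ~ c} − #P_b(G₁)` (**`slackCF_pendant`**), and by Theorem P (a)
`#P_b ≤ #{a ~ c}`: **contracting a pendant mark edge never raises the C-026 slack** —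
`Δ_CF(G₁; a, b, c) ≤ Δ_CF(G; a, b′, c)` (**`slackCF_pendant_ge`**); (CF) on `G₁` gives (CF) on `G`.
-/

namespace PercRepro

open Finset

namespace MultiGraph

section PendantMark

variable {V E : Type*} {G : MultiGraph V E}

/-- On a side consisting of the single edge `e₀ = bb′` (`b′ ≠ b`), `b ~ b′` iff that edge is open. -/
theorem conn_single_edge_iff {side : E → Bool} {b b' : V} (hbb : b' ≠ b) {e₀ : E} (he₀ : side e₀ = false)
    (huniq : ∀ e, side e = false → e = e₀) (hend : G.fst e₀ = b ∧ G.snd e₀ = b')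
    (ω₂ : Config {e // side e = false}) :
    (G.part side false).Conn ω₂ b b' ↔ ω₂ ⟨e₀, he₀⟩ = true := by
  constructor
  · intro h
    have key : ∀ z, (G.part side false).Conn ω₂ b z → z = b ∨ ω₂ ⟨e₀, he₀⟩ = true := by
      intro z hz
      refine Conn.induction (motive := fun z => z = b ∨ ω₂ ⟨e₀, he₀⟩ = true) (Or.inl rfl) ?_ hz
      intro x y _ hxy _
      obtain ⟨e, he, _⟩ := hxy
      have : e = ⟨e₀, he₀⟩ := Subtype.ext (huniq e.1 e.2)
      rw [this] at he
      exact Or.inr he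
    rcases key b' h with h1 | h1
    · exact absurd h1 hbb
    · exact h1
  · intro h
    exact Conn.of_openAdj ⟨⟨e₀, he₀⟩, h, Or.inl ⟨hend.1, hend.2⟩⟩

open Classical in
/-- The cube of a one-edge side: exactly one configuration has the edge open. -/
theorem card_single_edge_open [Fintype E] {side : E → Bool} {e₀ : E} (he₀ : side e₀ = false)
    (huniq : ∀ e, side e = false → e = e₀) :
    (univ.filter fun ω₂ : Config {e // side e = false} => ω₂ ⟨e₀, he₀⟩ = true).card = 1 := by
  rw [Finset.card_eq_one]
  refine ⟨fun _ => true, ?_⟩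
  ext ω₂
  simp only [Finset.mem_filter, Finset.mem_univ, true_and, Finset.mem_singleton]
  constructor
  · intro h
    funext e
    have : e = ⟨e₀, he₀⟩ := Subtype.ext (huniq e.1 e.2)
    rw [this]
    exact h
  · intro h
    rw [h]

open Classical in
/-- The cube of a one-edge side: exactly one configuration has the edge closed. -/
theorem card_single_edge_closed [Fintype E] {side : E → Bool} {e₀ : E} (he₀ : side e₀ = false)
    (huniq : ∀ e, side e = false → e = e₀) :
    (univ.filter fun ω₂ : Config {e // side e = false} => ¬ ω₂ ⟨e₀, he₀⟩ = true).card = 1 := by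
  rw [Finset.card_eq_one]
  refine ⟨fun _ => false, ?_⟩
  ext ω₂
  simp only [Finset.mem_filter, Finset.mem_univ, true_and, Finset.mem_singleton]
  constructor
  · intro h
    funext e
    have : e = ⟨e₀, he₀⟩ := Subtype.ext (huniq e.1 e.2)
    rw [this]
    simpa using h
  · intro h
    rw [h]
    simp

open Classical in
/-- **Theorem B (B4)**: for the pendant mark `b′` at `b` (the side `false` of the cut vertex `b` is the single
edge `e₀ = bb′`; `a, c` on side `true`), `Δ_CF(G; a, b′, c) = Δ_CF(G₁; a, b, c) + #{a ~ c}(G₁) − #P_b(G₁)`. -/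
theorem slackCF_pendant [Fintype E] {side : E → Bool} {a b b' c : V} (hg : G.IsGluing b b b side)
    (ha : G.OnSide side true a) (hc : G.OnSide side true c) (hb' : G.OnSide side false b')
    (hab : a ≠ b') (hcb : c ≠ b') (hbb : b' ≠ b) {e₀ : E} (he₀ : side e₀ = false)
    (huniq : ∀ e, side e = false → e = e₀) (hend : G.fst e₀ = b ∧ G.snd e₀ = b') :
    G.slackCF a b' c =
      (G.part side true).slackCF a b c +
        ((univ.filter fun ω₁ : Config {e // side e = true} => (G.part side true).Conn ω₁ c a).card : ℤ) -
        ((univ.filter fun ω₁ : Config {e // side e = true} =>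
          (G.part side true).Conn ω₁ a b ∧ (G.part side true).Conn ω₁ᶜ c b ∧
            ¬ (G.part side true).Conn ω₁ᶜ c a).card : ℤ) := by
  rw [slackCF_cut_b hg ha hb' hc hab hcb]
  have hu : (univ.filter fun ω₂ : Config {e // side e = false} =>
      (G.part side false).Conn ω₂ b b').card = 1 := by
    rw [Finset.filter_congr fun ω₂ _ => conn_single_edge_iff hbb he₀ huniq hend ω₂]
    exact card_single_edge_open he₀ huniq
  have ht : (univ.filter fun ω₂ : Config {e // side e = false} =>
      ¬ (G.part side false).Conn ω₂ b b').card = 1 := by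
    rw [Finset.filter_congr fun ω₂ _ => not_congr (conn_single_edge_iff hbb he₀ huniq hend ω₂)]
    exact card_single_edge_closed he₀ huniq
  have hp : (univ.filter fun ω₂ : Config {e // side e = false} =>
      (G.part side false).Conn ω₂ b b' ∧ ¬ (G.part side false).Conn ω₂ᶜ b b').card = 1 := by
    have e1 : (univ.filter fun ω₂ : Config {e // side e = false} =>
        (G.part side false).Conn ω₂ b b' ∧ ¬ (G.part side false).Conn ω₂ᶜ b b') =
        (univ.filter fun ω₂ : Config {e // side e = false} => ω₂ ⟨e₀, he₀⟩ = true) := by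
      refine Finset.filter_congr fun ω₂ _ => ?_
      rw [conn_single_edge_iff hbb he₀ huniq hend ω₂, conn_single_edge_iff hbb he₀ huniq hend ω₂ᶜ,
        compl_apply_not]
      cases hω : ω₂ ⟨e₀, he₀⟩ <;> simp
    rw [e1]
    exact card_single_edge_open he₀ huniq
  rw [hu, ht, hp]
  push_cast
  ring

open Classical in
/-- **Theorem P**: contracting a pendant mark edge never raises the C-026 slack —
`Δ_CF(G₁; a, b, c) ≤ Δ_CF(G; a, b′, c)`. -/
theorem slackCF_pendant_ge [Fintype E] {side : E → Bool} {a b b' c : V} (hg : G.IsGluing b b b side)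
    (ha : G.OnSide side true a) (hc : G.OnSide side true c) (hb' : G.OnSide side false b')
    (hab : a ≠ b') (hcb : c ≠ b') (hbb : b' ≠ b) {e₀ : E} (he₀ : side e₀ = false)
    (huniq : ∀ e, side e = false → e = e₀) (hend : G.fst e₀ = b ∧ G.snd e₀ = b') :
    (G.part side true).slackCF a b c ≤ G.slackCF a b' c := by
  rw [slackCF_pendant hg ha hc hb' hab hcb hbb he₀ huniq hend]
  have hP : (univ.filter fun ω₁ : Config {e // side e = true} =>
      (G.part side true).Conn ω₁ a b ∧ (G.part side true).Conn ω₁ᶜ c b ∧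
        ¬ (G.part side true).Conn ω₁ᶜ c a).card ≤
      (univ.filter fun ω₁ : Config {e // side e = true} => (G.part side true).Conn ω₁ c a).card := by
    convert card_pv_le (G := G.part side true) a c b using 4
  have := Nat.cast_le (α := ℤ) |>.mpr hP
  linarith

end PendantMark

end MultiGraph

end PercRepro
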